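/-
Origin: expansion seat `planner-pub-hodgecm-toy-g4-0`, handover #3 2026-08-18T13:04:50Z (md5 fec15119) (`HOME/pub-hodgecm-toy-g4/lean/ToyG4/ProdSection3.lean`, md5 fec15119, 139 lines);
landed by the gen-8 packager in gate run 30 as `HodgeCM/Model/ToyG2/ProdSection3.lean` (import ^import ToyG4\.WeightDual3[ \t]*$→import HodgeCM.Model.ToyG2.WeightDual3 ×1).
-/
/-
Copyright: pub-hodgecm formalisation cell (harness21, 2026). New file (not vendored).
Origin: HOME/pub-hodgecm-toy-g4/lean/ToyG4/ProdSection3.lean — session planner-pub-hodgecm-toy-g4-0 (unit pub-hodgecm-toy-g4),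
EXPANSION part (e) CONSISTENCY WITNESS, generation 4.  Intended final place: `HodgeCM/Model/ToyG2/ProdSection3.lean`
(module `HodgeCM.Model.ToyG2.ProdSection3`).  WIP module names: this file `ToyG4.ProdSection3`; its import `ToyG4.WeightDual3`
= `HodgeCM.Model.ToyG2.WeightDual3` (this seat, same run).  ADDITIVE: new declaration names only, nothing landed is edited,
nothing imports this file.
-/
import Summits.HodgeConjecture.HodgeCM.Proofs.Pohlmann.FactorActDescent_2
import Summits.HodgeConjecture.HodgeCM.Assembly.OpenInputsGeometric
import Summits.HodgeConjecture.HodgeCM.Model.ToyG2.WeightDual3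

/-!
# F2 `Fact_factorActDescends` in `toyUniverse₃`, and the geometric record modulo F7

toy2-g6's `HodgeCM.Proofs.Pohlmann.FactorActDescent` (run 29) derives F2 = M35 `Universe.Fact_factorActDescends`
(`StubTree/Qw8Geometric.lean`) from `ModelAxioms`, N1 `Fact_cupExterior`, N3 `Fact_pull_H0` and the structural fact
`Universe.Fact_prodSection` ("both projections of `X × Y` have sections"), and checks `Fact_prodSection` in the
generation-1 model (`HodgeCM.Toy.fact_prodSection`).  This file does the same for the generation-2/3 universes
`toyModel3With D T pl` (morphisms = BLOCK-ADMISSIBLE Hodge maps of `H¹`-lattices, `Obj₂.Hom₂`): the zero lattice map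
is a Hodge map and is block-admissible (`Obj₂.Adm.zero`: zero on every Picard block), so `lift id 0 : X → X × Y` and
`lift 0 id : Y → X × Y` are morphisms and sections of the projections (`Obj₂.Hom₂.lift_comp_fst/snd`).  Hence

* `fact3_prodSection (D T pl) : (toyModel3With D T pl).Fact_prodSection` (no hypotheses, any Hodge datum / trace /
  block supply);
* `fact3_factorActDescends (D T pl) (M : ModelAxioms) : Fact_factorActDescends`, `toyUniverse₃_factorActDescends_all
  (d t : ℚ) : (toyUniverse₃ d t).Fact_factorActDescends` — F2 holds in `toyUniverse₃`;
* with `WeightDual3` (F6) and toy-g3's `TrTopAll3`: **TEN of the eleven `Universe`-level fact binders of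
  `Assembly.COR_CM_of_openInputsGeometric` hold JOINTLY in `toyUniverse₃ d t` (`1 ≤ d`, `t² = 16`)** —
  `ModelAxioms`, `RealisationExistsFace`, N1–N4, F2, F4, F5, F6 (plus `RealisationExistsPerL`, M40, T-CM,
  `Fact_prodSection`): `toyUniverse₃_geometricFacts_but_gysin_all`, `exists_geometricFacts_but_gysin`; the ONE
  missing binder is F7 `Fact_gysin` (pv03-g7's claim for `toyModel3With`, run 30);
* `toyUniverse₃_openInputsGeometric_of_gysin (hd) (ht) (h7 : Fact_gysin) : OpenInputsGeometric` and
  `exists_modelAxioms_and_openInputsGeometric_of_gysin`: the WHOLE geometric record `OpenInputsGeometric`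
  (both theta-realisation inputs via pv03's `ThetaUiso.realisationExistsPerL₃ / Face₃` + the nine facts) in
  `toyUniverse₃`, from F7 alone — so a proof of `(toyUniverse₃ d t).Fact_gysin` makes `ModelAxioms ∧
  OpenInputsGeometric` WITNESSED (the geometric analogue of toy-g3's `exists_modelAxioms_and_openInputs`).

Scope as in `WeightDual3`: a toy witness; nothing about the intended model or about PerL / [QW8] themselves.
-/

noncomputable section

namespace HodgeCM

namespace ToyG2

open Toy

/-! ## 1. The zero morphism and product sections in `toyModel3With` -/

/-- The zero map of `H¹`-lattices is a Hodge map (it kills `F¹`). -/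
theorem isHodge_zero₃ (X Y : Obj) : Obj.IsHodge (X := X) (Y := Y) (0 : Y.L →ₗ[ℚ] X.L) := by
  unfold Obj.IsHodge
  rw [LinearMap.baseChange_zero, Submodule.map_zero]
  exact bot_le

/-- The zero morphism `X ⟶ Y` of generation-2 objects: the zero lattice map, block-admissible because it is zero
on every Picard block (`Obj₂.Adm.zero`). -/
def zeroHom₂ (X Y : Obj₂) : Obj₂.Hom₂ X Y := ⟨⟨0, isHodge_zero₃ X.toObj Y.toObj⟩, Obj₂.Adm.zero X Y⟩

/-- (Ported verbatim from the HodgeCMPerL package; no docstring in the source.) -/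
@[simp] theorem zeroHom₂_lin (X Y : Obj₂) : (zeroHom₂ X Y).lin = 0 := rfl

variable (D : HodgeData) (T : TraceSys) (pl : GBlocks)

/-- **`Fact_prodSection` in `toyModel3With D T pl`** (no hypotheses): `lift id 0` and `lift 0 id` are sections
of `fst` and `snd`. -/
theorem fact3_prodSection : (toyModel3With D T pl).Fact_prodSection := fun X Y =>
  ⟨⟨Obj₂.Hom₂.lift (Obj₂.Hom₂.id X.X) (zeroHom₂ X.X Y.X), Obj₂.Hom₂.lift_comp_fst _ _⟩,
    ⟨Obj₂.Hom₂.lift (zeroHom₂ Y.X X.X) (Obj₂.Hom₂.id Y.X), Obj₂.Hom₂.lift_comp_snd _ _⟩⟩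

/-! ## 2. F2 in the generation-3 models -/

/-- **F2 `Fact_factorActDescends` in `toyModel3With D T pl`**, given `ModelAxioms` — toy2-g6's generic derivation
`Universe.fact_factorActDescends_of_prodSection` applied to toy-g3's N1 / N3 and `fact3_prodSection`. -/
theorem fact3_factorActDescends (M : (toyModel3With D T pl).ModelAxioms) :
    (toyModel3With D T pl).Fact_factorActDescends :=
  Universe.fact_factorActDescends_of_prodSection M (fact3_cupExterior D T pl) (fact3_pull_H0 D T pl)
    (fact3_prodSection D T pl)

/-- `Fact_prodSection` in `toyUniverse₃ d t`. -/
theorem toyUniverse₃_prodSection (d t : ℚ) : (toyUniverse₃ d t).Fact_prodSection :=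
  fact3_prodSection exteriorHodgeData traceSys (gplOf d t)

/-- **F2 in `toyUniverse₃ d t` — no hypotheses.** -/
theorem toyUniverse₃_factorActDescends_all (d t : ℚ) : (toyUniverse₃ d t).Fact_factorActDescends :=
  fact3_factorActDescends exteriorHodgeData traceSys (gplOf d t) (toyUniverse₃_modelAxioms_all d t)

/-! ## 3. Ten of the eleven geometric binders, jointly -/

/-- **All `Universe`-level fact binders of `COR_CM_of_openInputsGeometric` except F7, jointly, in `toyUniverse₃ d t`**
(`1 ≤ d`, `t² = 16`), together with `RealisationExistsPerL`, M40, T-CM and `Fact_prodSection`: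
`ModelAxioms ∧ RealisationExistsPerL ∧ RealisationExistsFace ∧ N1 ∧ N2 ∧ N3 ∧ N4 ∧ F2 ∧ F4 ∧ F5 ∧ F6 ∧ Fact_dimProd ∧
Fact_trTopCM ∧ Fact_prodSection`. -/
theorem toyUniverse₃_geometricFacts_but_gysin_all (d t : ℚ) (hd : 1 ≤ d) (ht : t ^ 2 = 16) :
    (toyUniverse₃ d t).ModelAxioms ∧ (toyUniverse₃ d t).RealisationExistsPerL ∧
      (toyUniverse₃ d t).RealisationExistsFace ∧
      (toyUniverse₃ d t).Fact_cupExterior ∧ (toyUniverse₃ d t).Fact_cup_hodge ∧ (toyUniverse₃ d t).Fact_pull_H0 ∧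
      (toyUniverse₃ d t).Fact_hodge_F0 ∧ (toyUniverse₃ d t).Fact_factorActDescends ∧
      (toyUniverse₃ d t).Fact_cupAlg ∧ (toyUniverse₃ d t).Fact_cupAssoc ∧ (toyUniverse₃ d t).Fact_weightDual ∧
      (toyUniverse₃ d t).Fact_dimProd ∧ (toyUniverse₃ d t).Fact_trTopCM ∧ (toyUniverse₃ d t).Fact_prodSection := by
  obtain ⟨hM, hR, h1, h2, h3, h4, h5, h6, h7, h8⟩ := toyUniverse₃_genericFacts_but_gysin_all d t hd ht
  exact ⟨hM, ThetaUiso.realisationExistsPerL₃ d t hd ht, hR, h1, h2, h3, h4, toyUniverse₃_factorActDescends_all d t,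
    h5, h6, toyUniverse₃_weightDual_all d t, h7, h8, toyUniverse₃_prodSection d t⟩

/-- The existential form (witness `d = 1`, `t = 4`). -/
theorem exists_geometricFacts_but_gysin : ∃ U : Universe,
    U.ModelAxioms ∧ U.RealisationExistsPerL ∧ U.RealisationExistsFace ∧ U.Fact_cupExterior ∧ U.Fact_cup_hodge ∧
      U.Fact_pull_H0 ∧ U.Fact_hodge_F0 ∧ U.Fact_factorActDescends ∧ U.Fact_cupAlg ∧ U.Fact_cupAssoc ∧
      U.Fact_weightDual ∧ U.Fact_dimProd ∧ U.Fact_trTopCM ∧ U.Fact_prodSection :=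
  ⟨toyUniverse₃ 1 4, toyUniverse₃_geometricFacts_but_gysin_all 1 4 le_rfl (by norm_num)⟩

/-! ## 4. The geometric record from F7 alone -/

/-- **`OpenInputsGeometric` for `toyUniverse₃ d t` from F7 `Fact_gysin` alone** (`1 ≤ d`, `t² = 16`). -/
theorem toyUniverse₃_openInputsGeometric_of_gysin (d t : ℚ) (hd : 1 ≤ d) (ht : t ^ 2 = 16)
    (h7 : (toyUniverse₃ d t).Fact_gysin) : (toyUniverse₃ d t).OpenInputsGeometric := by
  obtain ⟨-, hP, hR, h1, h2, h3, h4, hF2, hF4, hF5, hF6, -, -, -⟩ :=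
    toyUniverse₃_geometricFacts_but_gysin_all d t hd ht
  exact ⟨hP, hR, h1, h2, h3, h4, hF2, hF4, hF5, hF6, h7⟩

/-- Hence: a proof of F7 for `toyUniverse₃ d t` (some `1 ≤ d`, `t² = 16`) makes `ModelAxioms ∧ OpenInputsGeometric`
WITNESSED. -/
theorem exists_modelAxioms_and_openInputsGeometric_of_gysin {d t : ℚ} (hd : 1 ≤ d) (ht : t ^ 2 = 16)
    (h7 : (toyUniverse₃ d t).Fact_gysin) : ∃ U : Universe, U.ModelAxioms ∧ U.OpenInputsGeometric :=
  ⟨toyUniverse₃ d t, toyUniverse₃_modelAxioms_all d t, toyUniverse₃_openInputsGeometric_of_gysin d t hd ht h7⟩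

/-- … and then the geometric end state `COR_CM_of_openInputsGeometric` is INSTANTIATED (non-vacuously) in the toy:
its conclusion `HC_CM` for `toyUniverse₃ d t` follows from F7 alone by that theorem. -/
theorem toyUniverse₃_hcCM_by_geometric_of_gysin (d t : ℚ) (hd : 1 ≤ d) (ht : t ^ 2 = 16)
    (h7 : (toyUniverse₃ d t).Fact_gysin) : (toyUniverse₃ d t).HC_CM :=
  Assembly.COR_CM_of_openInputsGeometric (toyUniverse₃ d t) (toyUniverse₃_modelAxioms_all d t)
    (toyUniverse₃_openInputsGeometric_of_gysin d t hd ht h7)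

end ToyG2

end HodgeCM

end
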